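import Summits.CriticalPhenomena.SAWScalingLimit.Theorems.SAWDevelopingMapHexConjectureTwoPointTailBound
import Summits.CriticalPhenomena.SAWScalingLimit.Theorems.SAWDevelopingMapHexConjectureFarSideTriangleTail
import Summits.CriticalPhenomena.SAWScalingLimit.Theorems.SAWDevelopingMapHexConjectureKPDefs
import HarnessLib

/-!
# Crux `HexConjecture` (stmt-CriticalPhenomena-0808), line `root-locality-replaces-loewner`:
the WINDOW TAIL input of Krachun–Panagiotis' decay lemma — the window masses along the geometric
scales `T_j = 22ʲ T₀` sum to at most the triangle tail `2(cos(π/8)/cos(3π/8))·D^Δ(T₀ − 1)`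

Landing target:
`Summits/CriticalPhenomena/SAWScalingLimit/Theorems/SAWDevelopingMapHexConjectureKPWindowTail.lean`
(`--supports stmt-CriticalPhenomena-0808`; registered stub `stub_kp_windowTail`).

The window mass `W T` of the lead's decay lemma (`stub_kp_decay`, `…KPDecay.lean`) is the critical
`x_c`-mass of the mid-edge walks of the Duminil-Copin–Smirnov strip `S_{32T+1,32T+1}` from the root
mid-edge to the floor mid-edge at abscissa `d`, summed over the window `d ∈ [T, 21T]` — Krachun–Panagiotis'
`Σ_{k=T}^{21T} G_k` confined to a strip.  In the proof of [KP, Lemma 3.4] the windows at the scales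
`T_j := 22ʲ T₀`, `j < B`, are pairwise DISJOINT, so `Σ_{j<B} W(T_j) ≤ Σ_{k ≥ T₀} G_k ≤ 2 D_{2T₀−1}`
([KP, Lemma 2.2]).  Here, in the tree's vocabulary:

* `kpScale_le`, `kpWindow_disjoint`, `kpWindow_pairwiseDisjoint`, `mem_kpWindow`: the arithmetic of
  the scales (`22ʲ ≤ 22ᴮ`, `21·22ʲ T₀ < 22ʲ⁺¹ T₀ ≤ 22ᵏ T₀` for `j < k`, `T₀ ≤ d ≤ 21·22ᴮ T₀` on the union);
* `codedWindowSum_le_sub_triA`: KP Lemma 2.2 for the coded strip sums — for offsets `L + 1 ≤ |d| ≤ N + 1`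
  the coded floor-arch masses of `S_{N+1,N+1}` sum to at most `1/cos(3π/8) − A^Δ(L)` (the coded sum IS
  the half-strip arch mass at the root cell, `archMass_halfStrip_offset`, and `farOffsetMass_le_sub_triA`);
* `kpWindow_sum_le`: every strip `S_{32T_j+1}` sits inside the largest one `S_{32·22ᴮT₀+1}`
  (`hvArchSum_mono`), the disjoint windows merge into one offset set (`Finset.sum_biUnion`), and
  `codedWindowSum_le_sub_triA` with `L := T₀ − 1` applies;
* `stub_kp_windowTail`: rewrite `W` by its specification and `1/cos(3π/8) − A^Δ = 2(cos(π/8)/cos(3π/8))·D^Δ_l`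
  (`inv_cos_sub_triA_eq_two_mul`).
Sources: Krachun–Panagiotis, arXiv:2310.17299 = Ann. Probab. 2026, Lemma 2.2 and the proof of Lemma 3.4
(p. 17, "T_j := 22^{…+j}"); Glazman–Manolescu, Lemma 4.1; Duminil-Copin–Smirnov 2012, Lemma 2 and §3.
-/

noncomputable section

open scoped BigOperators Topology Classical
open Filter Set
open Literature.Probability.LatticeModels (HexVertex hexGraph hexCenter Site)
open Literature.Probability.RandomPlanarGeometry
open Literature.Probability.RandomPlanarGeometry.SAW
open Literature.Probability.RandomPlanarGeometry.SAW.HV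
open Summit.CriticalPhenomena.SAWScalingLimit.Theorems.ObservableToSLE.FloorRatio

namespace Summit.CriticalPhenomena.SAWScalingLimit.Theorems.HexConjecture.RootLocality

/-! ### The arithmetic of the geometric scales `T_j = 22ʲ T₀` -/

/-- Every scale below `B` gives a strip inside the largest one: `32·22ʲT₀ ≤ 32·22ᴮT₀` for `j < B`.
[cite: KrachunPanagiotis2026, proof of Lemma 3.4 (T_j := 22^j T₀)] -/
theorem kpScale_le {T₀ B j : ℕ} (hj : j ∈ Finset.range B) :
    32 * (22 ^ j * T₀) ≤ 32 * (22 ^ B * T₀) :=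
  Nat.mul_le_mul_left _ (Nat.mul_le_mul_right _
    (Nat.pow_le_pow_right (by norm_num) (Finset.mem_range.1 hj).le))

/-- **The windows are disjoint**: for `j < k` and `T₀ ≥ 1`, `[22ʲT₀, 21·22ʲT₀] ∩ [22ᵏT₀, 21·22ᵏT₀] = ∅`
(`21·22ʲT₀ < 22ʲ⁺¹T₀ ≤ 22ᵏT₀`). [cite: KrachunPanagiotis2026, proof of Lemma 3.4 (T_j := 22^j T₀)] -/
theorem kpWindow_disjoint {T₀ j k : ℕ} (hT₀ : 1 ≤ T₀) (hjk : j < k) :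
    Disjoint (Finset.Icc ((22 ^ j * T₀ : ℕ) : ℤ) (21 * ((22 ^ j * T₀ : ℕ) : ℤ)))
      (Finset.Icc ((22 ^ k * T₀ : ℕ) : ℤ) (21 * ((22 ^ k * T₀ : ℕ) : ℤ))) := by
  have h1 : 22 * (22 ^ j * T₀) ≤ 22 ^ k * T₀ := by
    rw [← mul_assoc, ← pow_succ']
    exact Nat.mul_le_mul_right _ (Nat.pow_le_pow_right (by norm_num) hjk)
  have h2 : T₀ ≤ 22 ^ j * T₀ := Nat.le_mul_of_pos_left _ (by positivity)
  generalize 22 ^ j * T₀ = a at h1 h2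
  generalize 22 ^ k * T₀ = b at h1
  rw [Finset.disjoint_left]
  intro d hd hd'
  rw [Finset.mem_Icc] at hd hd'
  omega

/-- The family of windows `j ↦ [22ʲT₀, 21·22ʲT₀]`, `j < B`, is pairwise disjoint.
[cite: KrachunPanagiotis2026, proof of Lemma 3.4 (T_j := 22^j T₀)] -/
theorem kpWindow_pairwiseDisjoint (T₀ : ℕ) (hT₀ : 1 ≤ T₀) (B : ℕ) :
    (↑(Finset.range B) : Set ℕ).PairwiseDisjoint
      (fun j => Finset.Icc ((22 ^ j * T₀ : ℕ) : ℤ) (21 * ((22 ^ j * T₀ : ℕ) : ℤ))) := by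
  intro j _ k _ hjk
  rcases Nat.lt_or_gt_of_ne hjk with h | h
  · exact kpWindow_disjoint hT₀ h
  · exact (kpWindow_disjoint hT₀ h).symm

/-- On the union of the windows below `B` the offsets satisfy `T₀ ≤ d ≤ 21·22ᴮT₀`.
[cite: KrachunPanagiotis2026, proof of Lemma 3.4 (T_j := 22^j T₀)] -/
theorem mem_kpWindow {T₀ B : ℕ} {d : ℤ}
    (hd : d ∈ (Finset.range B).biUnion
      fun j => Finset.Icc ((22 ^ j * T₀ : ℕ) : ℤ) (21 * ((22 ^ j * T₀ : ℕ) : ℤ))) :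
    (T₀ : ℤ) ≤ d ∧ d ≤ 21 * ((22 ^ B * T₀ : ℕ) : ℤ) := by
  obtain ⟨j, hj, hd⟩ := Finset.mem_biUnion.1 hd
  rw [Finset.mem_Icc] at hd
  have h1 : T₀ ≤ 22 ^ j * T₀ := Nat.le_mul_of_pos_left _ (by positivity)
  have h2 : 22 ^ j * T₀ ≤ 22 ^ B * T₀ :=
    Nat.mul_le_mul_right _ (Nat.pow_le_pow_right (by norm_num) (Finset.mem_range.1 hj).le)
  generalize 22 ^ j * T₀ = a at hd h1 h2
  generalize 22 ^ B * T₀ = b at h2 ⊢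
  omega

/-! ### Krachun–Panagiotis Lemma 2.2 for the coded strip sums -/

/-- **KP Lemma 2.2 in a strip.**  For offsets `d` with `L + 1 ≤ |d| ≤ N + 1` on `U`, the coded critical
floor-arch masses of the strip `S_{N+1,N+1}` sum to at most `1/cos(3π/8) − A^Δ(L)`: at any root cell `x` the
coded sum at offset `d` is the arch mass `Z_{S_x(N)}(s_x → t_{x + d e₀})` (`archMass_halfStrip_offset`), and
`S_x(N)` lies in the rows `≥ x₁` (`halfStrip_geometry`), so `farOffsetMass_le_sub_triA` applies.
[cite: KrachunPanagiotis2026, Lemma 2.2; GlazmanManolescu2019, Lemma 4.1] -/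
theorem codedWindowSum_le_sub_triA (x : Site 2) (N L : ℕ) (U : Finset ℤ)
    (hU₁ : ∀ d ∈ U, (L : ℤ) + 1 ≤ |d|) (hU₂ : ∀ d ∈ U, |d| ≤ N + 1) :
    ∑ d ∈ U, ∑ P ∈ (midWalks (stripV (N + 1) (N + 1))).filter
        (fun P => finalDart P = ((d, 0, false), (d, -1, true)) ∨
          finalDart P = ((d, -1, true), (d, 0, false))), hexCriticalFugacity ^ mwLen P ≤
      (Real.cos (3 * Real.pi / 8))⁻¹ - triA L := by
  have e : ∀ d ∈ U, ∑ P ∈ (midWalks (stripV (N + 1) (N + 1))).filter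
        (fun P => finalDart P = ((d, 0, false), (d, -1, true)) ∨
          finalDart P = ((d, -1, true), (d, 0, false))), hexCriticalFugacity ^ mwLen P =
      ∑ γ : HexMidEdgeSAW ((stripV (N + 1) (N + 1)).map
          (hvIso.trans (shift (-(x 0)) (-(x 1)))).symm.toEquiv.toEmbedding)
        s((x - Pi.single 1 1, 1), (x, 0))
        s((x + Pi.single 0 d - Pi.single 1 1, 1), (x + Pi.single 0 d, 0)),
        hexCriticalFugacity ^ γ.length := fun d hd =>
    (archMass_halfStrip_offset x N d (hU₂ d hd)).symm
  rw [Finset.sum_congr rfl e]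
  exact farOffsetMass_le_sub_triA x _ (fun v hv => (halfStrip_geometry hv).1) L U hU₁

/-! ### The window tail -/

/-- **The summed window masses are at most the triangle tail** (coded form): for `T₀ ≥ 1` and every `B`,
`Σ_{j<B} Σ_{d ∈ [T_j, 21T_j]} (coded arch mass of S_{32T_j+1,32T_j+1} at d) ≤ 1/cos(3π/8) − A^Δ(T₀ − 1)`,
`T_j = 22ʲT₀` — monotonicity in the strip (`hvArchSum_mono`), disjointness of the windows
(`kpWindow_pairwiseDisjoint`) and KP Lemma 2.2 (`codedWindowSum_le_sub_triA`).
[cite: KrachunPanagiotis2026, Lemma 2.2 and proof of Lemma 3.4] -/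
theorem kpWindow_sum_le (T₀ : ℕ) (hT₀ : 1 ≤ T₀) (B : ℕ) :
    ∑ j ∈ Finset.range B, ∑ d ∈ Finset.Icc ((22 ^ j * T₀ : ℕ) : ℤ) (21 * ((22 ^ j * T₀ : ℕ) : ℤ)),
      ∑ P ∈ (midWalks (stripV (32 * (22 ^ j * T₀) + 1) (32 * (22 ^ j * T₀) + 1))).filter
          (fun P => finalDart P = ((d, 0, false), (d, -1, true)) ∨
            finalDart P = ((d, -1, true), (d, 0, false))),
        hexCriticalFugacity ^ mwLen P ≤ (Real.cos (3 * Real.pi / 8))⁻¹ - triA (T₀ - 1) := by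
  have hU₁ : ∀ d ∈ (Finset.range B).biUnion
      (fun j => Finset.Icc ((22 ^ j * T₀ : ℕ) : ℤ) (21 * ((22 ^ j * T₀ : ℕ) : ℤ))),
      ((T₀ - 1 : ℕ) : ℤ) + 1 ≤ |d| := by
    intro d hd
    have h := (mem_kpWindow hd).1
    rw [abs_of_nonneg (by omega)]
    omega
  have hU₂ : ∀ d ∈ (Finset.range B).biUnion
      (fun j => Finset.Icc ((22 ^ j * T₀ : ℕ) : ℤ) (21 * ((22 ^ j * T₀ : ℕ) : ℤ))),
      |d| ≤ ((32 * (22 ^ B * T₀) : ℕ) : ℤ) + 1 := by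
    intro d hd
    have h := mem_kpWindow hd
    rw [abs_of_nonneg (by omega)]
    generalize 22 ^ B * T₀ = b at h
    push_cast
    omega
  calc _ ≤ ∑ j ∈ Finset.range B,
        ∑ d ∈ Finset.Icc ((22 ^ j * T₀ : ℕ) : ℤ) (21 * ((22 ^ j * T₀ : ℕ) : ℤ)),
        ∑ P ∈ (midWalks (stripV (32 * (22 ^ B * T₀) + 1) (32 * (22 ^ B * T₀) + 1))).filter
            (fun P => finalDart P = ((d, 0, false), (d, -1, true)) ∨
              finalDart P = ((d, -1, true), (d, 0, false))),
          hexCriticalFugacity ^ mwLen P :=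
        Finset.sum_le_sum fun j hj => Finset.sum_le_sum fun d _ => hvArchSum_mono d (kpScale_le hj)
    _ = ∑ d ∈ (Finset.range B).biUnion
          (fun j => Finset.Icc ((22 ^ j * T₀ : ℕ) : ℤ) (21 * ((22 ^ j * T₀ : ℕ) : ℤ))),
        ∑ P ∈ (midWalks (stripV (32 * (22 ^ B * T₀) + 1) (32 * (22 ^ B * T₀) + 1))).filter
            (fun P => finalDart P = ((d, 0, false), (d, -1, true)) ∨
              finalDart P = ((d, -1, true), (d, 0, false))),
          hexCriticalFugacity ^ mwLen P :=
        (Finset.sum_biUnion (kpWindow_pairwiseDisjoint T₀ hT₀ B)).symm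
    _ ≤ _ := codedWindowSum_le_sub_triA 0 (32 * (22 ^ B * T₀)) (T₀ - 1) _ hU₁ hU₂

/-- **Registered stub `stub_kp_windowTail`** (crux item stmt-CriticalPhenomena-0808, line
`root-locality-replaces-loewner`): the window-summability hypothesis of the decay lemma `stub_kp_decay`
for the confined window mass `W T = Σ_{d ∈ [T, 21T]} (coded arch mass of S_{32T+1,32T+1} at d)` with
`a = triDl` and `κ = 2 cos(π/8)/cos(3π/8)`: `Σ_{j<B} W(22ʲT₀) ≤ 2(cos(π/8)/cos(3π/8))·triDl(T₀ − 1)`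
(`kpWindow_sum_le` and `inv_cos_sub_triA_eq_two_mul`).
[cite: KrachunPanagiotis2026, Lemma 2.2 and proof of Lemma 3.4] -/
theorem stub_kp_windowTail : ∀ (W : ℕ → ℝ), (∀ T : ℕ, W T = ∑ d ∈ Finset.Icc (T : ℤ) (21 * T), ∑ P ∈ (Literature.Probability.RandomPlanarGeometry.SAW.HV.midWalks (Literature.Probability.RandomPlanarGeometry.SAW.HV.stripV (32 * T + 1) (32 * T + 1))).filter (fun P => Literature.Probability.RandomPlanarGeometry.SAW.HV.finalDart P = ((d, 0, false), (d, -1, true)) ∨ Literature.Probability.RandomPlanarGeometry.SAW.HV.finalDart P = ((d, -1, true), (d, 0, false))), Literature.Probability.RandomPlanarGeometry.SAW.hexCriticalFugacity ^ Literature.Probability.RandomPlanarGeometry.SAW.HV.mwLen P) → ∀ (T₀ : ℕ), 1 ≤ T₀ → ∀ (B : ℕ), ∑ j ∈ Finset.range B, W (22 ^ j * T₀) ≤ 2 * (Real.cos (Real.pi / 8) / Real.cos (3 * Real.pi / 8)) * Literature.Probability.RandomPlanarGeometry.SAW.HV.triDl (T₀ - 1) := by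
  intro W hW T₀ hT₀ B
  rw [Finset.sum_congr rfl fun j _ => hW (22 ^ j * T₀), ← inv_cos_sub_triA_eq_two_mul]
  exact kpWindow_sum_le T₀ hT₀ B

end Summit.CriticalPhenomena.SAWScalingLimit.Theorems.HexConjecture.RootLocality

end
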